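import Summits.AtomisticToContinuum.HydrodynamicLimit.Theorems.JParityClosureOddContactSymmetryHardCoreMarginals
import Literature.Analysis.FluidPDE.HardSphereTorusMeasure
import HarnessLib

/-!
# Static window events of the rung-0 Gibbs law (S1): one close pair, with the Boltzmann constant
# (helper toward the rung-0 collision-count bound; crux `JParityClosure.OddContactSymmetry`,
# stmt-AtomisticToContinuum-13078, line `equilibrium-rung-mean-variance`, transfer debt "tightness")

Lead prover r-1 of the crux.  Under the homogeneous local Gibbs law of `N + 1` hard spheres of
diameter `ε = hsDiameter σ N` on `𝕋³` (constant profiles; positions hard-core canonical, velocities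
i.i.d. Maxwellian — `localGibbsMeasure_rung0_eq_map`), the one-collision window event of the
first-moment collision-count argument:

* `localGibbsLaw_closePair_le` (S1) — some pair `i ≠ j` at distance in `[ε, ε + (‖vᵢ‖+‖vⱼ‖)δ]` has
  probability `≤ 12 v₁ ε² (N+1)N · 2E‖v‖ · δ + C₁ δ²`, with the SHARP shell volume `v₁((ε+w)³ − ε³)`
  (`volume_shell_le`, from the exact minimal-image ball volumes) — the `ε²` that makes the final count
  `O(σ² (N+1)^{4/3})` — the pair-marginal factor `2²` of `posGibbsMeasure_marginal_le`
  (`posGibbsMeasure_pairShell_le`), and the Maxwellian first/second moments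
  (`lintegral_pairWindow_le`, `prod_pairWindow_le`); union bound over the `(N+1)N` ordered pairs.

References: Cercignani–Illner–Pulvirenti 1994 §2.2 (collision cylinder); Gallagher–Saint-Raymond–Texier
2013, Lemma 4.1.2; Spohn 1991, Part I §2.3.
-/

noncomputable section

open MeasureTheory Set Filter Topology
open scoped ENNReal BigOperators

namespace Summit.AtomisticToContinuum.HydrodynamicLimit.Theorems

open Literature.Analysis.FluidPDE Literature.MathematicalPhysics.KineticTheory
  Literature.MathematicalPhysics.StatisticalMechanics

/-! ## (S1) the one-collision window event -/

open ProbabilityTheory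

/-- **Sharp Haar volume of a thin minimal-image shell.**  For `0 < ε`, `0 ≤ w`, `ε + w < 1/2` and
`z ∈ 𝕋³`: `vol {y | ε ≤ d(y, z) ≤ ε + w} ≤ v₁ ((ε + w)³ − ε³)`, the difference of the exact Haar
volumes `v₁ (ε + w)³` and `v₁ ε³` of the minimal-image balls (`Torus.volume_euclidDist_le`,
`Torus.volume_euclidDist_lt`), `v₁ = |B₁|`. [folklore] -/
theorem volume_shell_le {ε w : ℝ} (hε : 0 < ε) (hw : 0 ≤ w) (h : ε + w < 1 / 2) (z : T3) :
    volume {y : T3 | ε ≤ Torus.euclidDist y z ∧ Torus.euclidDist y z ≤ ε + w} ≤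
      ENNReal.ofReal (v₁ * ((ε + w) ^ 3 - ε ^ 3)) := by
  have hsub : {y : T3 | ε ≤ Torus.euclidDist y z ∧ Torus.euclidDist y z ≤ ε + w} =
      {y | Torus.euclidDist y z ≤ ε + w} \ {y | Torus.euclidDist y z < ε} := by
    ext y; simp [not_lt, and_comm]
  rw [hsub]
  have hcont : Continuous fun y : T3 => Torus.euclidDist y z := by
    have h1 := (Torus.continuous_norm_reprSym (d := Fin 3)).comp (continuous_sub_right z)
    simpa only [Function.comp_def, Torus.euclidDist] using h1
  have hs : MeasurableSet {y : T3 | Torus.euclidDist y z < ε} :=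
    measurableSet_lt hcont.measurable measurable_const
  refine (measure_sdiff_le_iff_le_add hs.nullMeasurableSet (fun y hy => ?_)
    (measure_ne_top _ _)).2 ?_
  · simp only [mem_setOf_eq] at hy ⊢
    linarith
  have hv : volume (Metric.ball (0 : EuclideanSpace ℝ (Fin 3)) 1) = ENNReal.ofReal v₁ := by
    rw [v₁, ENNReal.ofReal_toReal measure_ball_lt_top.ne]
  rw [Torus.volume_euclidDist_le h, Torus.volume_euclidDist_lt (show ε < 1 / 2 by linarith) z,
    Measure.addHaar_closedBall _ _ (by linarith), Measure.addHaar_ball_of_pos _ _ hε,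
    finrank_euclideanSpace, Fintype.card_fin, hv]
  calc ENNReal.ofReal ((ε + w) ^ 3) * ENNReal.ofReal v₁
      = ENNReal.ofReal ((ε + w) ^ 3 * v₁) := (ENNReal.ofReal_mul (by positivity)).symm
    _ = ENNReal.ofReal (ε ^ 3 * v₁ + v₁ * ((ε + w) ^ 3 - ε ^ 3)) := by congr 1; ring
    _ ≤ ENNReal.ofReal (ε ^ 3 * v₁) + ENNReal.ofReal (v₁ * ((ε + w) ^ 3 - ε ^ 3)) :=
        ENNReal.ofReal_add_le
    _ = ENNReal.ofReal (ε ^ 3) * ENNReal.ofReal v₁ +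
          ENNReal.ofReal (v₁ * ((ε + w) ^ 3 - ε ^ 3)) := by
        rw [ENNReal.ofReal_mul (by positivity)]

/-- **Two distinct coordinates of the Haar product measure** (Tonelli): if every section
`{y | (z, y) ∈ S}` of a measurable `S ⊆ 𝕋³ × 𝕋³` has Haar measure at most `C`, then
`vol {x ∈ (𝕋³)ⁿ | (xᵢ, xⱼ) ∈ S} ≤ C` for `i ≠ j` — the pair `(xᵢ, xⱼ)` is `Haar ⊗ Haar`
distributed (independence of the coordinates of a product measure, `iIndepFun_pi`). [folklore] -/
theorem volume_setOf_pair_le {n : ℕ} {i j : Fin n} (hij : i ≠ j) {S : Set (T3 × T3)}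
    (hS : MeasurableSet S) {C : ℝ≥0∞} (hC : ∀ z : T3, volume {y : T3 | (z, y) ∈ S} ≤ C) :
    volume {x : Fin n → T3 | (x i, x j) ∈ S} ≤ C := by
  have hind : IndepFun (fun x : Fin n → T3 => x i) (fun x => x j)
      (Measure.pi fun _ : Fin n => (volume : Measure T3)) :=
    (iIndepFun_pi (μ := fun _ : Fin n => (volume : Measure T3)) (X := fun _ => id)
      fun _ => aemeasurable_id).indepFun hij
  have hev : ∀ k : Fin n, (Measure.pi fun _ : Fin n => (volume : Measure T3)).map
      (fun x => x k) = volume := fun k =>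
    (measurePreserving_eval (fun _ : Fin n => (volume : Measure T3)) k).map_eq
  have hmap : (Measure.pi fun _ : Fin n => (volume : Measure T3)).map (fun x => (x i, x j)) =
      (volume : Measure T3).prod volume := by
    rw [(indepFun_iff_map_prod_eq_prod_map_map (measurable_pi_apply i).aemeasurable
      (measurable_pi_apply j).aemeasurable).1 hind, hev i, hev j]
  have hpre : {x : Fin n → T3 | (x i, x j) ∈ S} = (fun x : Fin n → T3 => (x i, x j)) ⁻¹' S := rfl
  have key : (Measure.pi fun _ : Fin n => (volume : Measure T3)) {x | (x i, x j) ∈ S} ≤ C := by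
    rw [hpre, ← Measure.map_apply ((measurable_pi_apply i).prodMk (measurable_pi_apply j)) hS,
      hmap, Measure.prod_apply hS]
    calc ∫⁻ z, volume (Prod.mk z ⁻¹' S) ∂(volume : Measure T3)
        ≤ ∫⁻ _, C ∂(volume : Measure T3) := lintegral_mono fun z => hC z
      _ = C := by rw [lintegral_const, measure_univ, mul_one]
  exact key

/-- **Haar volume of the pair-shell event.**  For `i ≠ j`, `0 < ε`, `0 ≤ w`, `ε + w < 1/2`:
`vol {x ∈ (𝕋³)ⁿ | ε ≤ d(xᵢ, xⱼ) ≤ ε + w} ≤ v₁ ((ε + w)³ − ε³)` (the pair is Haar ⊗ Haar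
distributed and every section is a thin minimal-image shell). [folklore] -/
theorem volume_pairShell_le {n : ℕ} {i j : Fin n} (hij : i ≠ j) {ε w : ℝ} (hε : 0 < ε)
    (hw : 0 ≤ w) (h : ε + w < 1 / 2) :
    volume {x : Fin n → T3 | ε ≤ Torus.euclidDist (x i) (x j) ∧
        Torus.euclidDist (x i) (x j) ≤ ε + w} ≤
      ENNReal.ofReal (v₁ * ((ε + w) ^ 3 - ε ^ 3)) := by
  have hS : MeasurableSet {p : T3 × T3 | ε ≤ Torus.euclidDist p.1 p.2 ∧
      Torus.euclidDist p.1 p.2 ≤ ε + w} :=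
    (measurableSet_le measurable_const continuous_euclidDist_prod.measurable).inter
      (measurableSet_le continuous_euclidDist_prod.measurable measurable_const)
  refine volume_setOf_pair_le hij hS fun z => ?_
  have hset : {y : T3 | (z, y) ∈ {p : T3 × T3 | ε ≤ Torus.euclidDist p.1 p.2 ∧
      Torus.euclidDist p.1 p.2 ≤ ε + w}} =
      {y : T3 | ε ≤ Torus.euclidDist y z ∧ Torus.euclidDist y z ≤ ε + w} := by
    ext y
    simp only [mem_setOf_eq, Torus.euclidDist_comm z y]
  rw [hset]
  exact volume_shell_le hε hw h z

/-- **The pair-shell event under the hard-core canonical measure, uniformly in the window.**  For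
`i ≠ j` and every `w ≥ 0`, with `ε = hsDiameter σ N` (`v₁σ³ ≤ 1/2`, `σ < 1/2`):
`posGibbs {ε ≤ d(xᵢ, xⱼ) ≤ ε + w} ≤ 12 v₁ ε² w + K(ε) w²` — for `ε + w < 1/2` by the pair
marginal bound `≤ 2² vol` (`posGibbsMeasure_marginal_le`) and the sharp shell volume
`v₁((ε + w)³ − ε³) = v₁(3ε²w + 3εw² + w³)`, otherwise by `prob ≤ 1 ≤ (w/(1/2 − ε))²`. [folklore] -/
theorem posGibbsMeasure_pairShell_le {a σ : ℝ} (ha : 0 < a) (hσ : 0 < σ) (hσ2 : σ < 1 / 2)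
    (hlam : v₁ * σ ^ 3 ≤ 1 / 2) (N : ℕ) {i j : Fin (N + 1)} (hij : i ≠ j) {w : ℝ} (hw : 0 ≤ w) :
    posGibbsMeasure (fun _ : T3 => a) (hsDiameter σ N) (N + 1)
        {x | hsDiameter σ N ≤ Torus.euclidDist (x i) (x j) ∧
          Torus.euclidDist (x i) (x j) ≤ hsDiameter σ N + w} ≤
      ENNReal.ofReal (12 * v₁ * hsDiameter σ N ^ 2 * w + (2 ^ 2 * v₁ * (3 * hsDiameter σ N + 1) + (1 / 2 - hsDiameter σ N)⁻¹ ^ 2) * w ^ 2) := by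
  have hε : 0 < hsDiameter σ N := hsDiameter_pos hσ N
  have hε2 : hsDiameter σ N < 1 / 2 := (hsDiameter_le hσ.le N).trans_lt hσ2
  have hs : 0 < 1 / 2 - hsDiameter σ N := by linarith
  have hv := v₁_pos
  by_cases hcase : hsDiameter σ N + w < 1 / 2
  · have hdm : Measurable fun x : Fin (N + 1) → T3 => Torus.euclidDist (x i) (x j) :=
      (continuous_euclidDist_apply i j).measurable
    have hBm : MeasurableSet {x : Fin (N + 1) → T3 | hsDiameter σ N ≤ Torus.euclidDist (x i) (x j) ∧
        Torus.euclidDist (x i) (x j) ≤ hsDiameter σ N + w} :=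
      (measurableSet_le measurable_const hdm).inter (measurableSet_le hdm measurable_const)
    have hBI : ∀ x y : Fin (N + 1) → T3, (∀ k ∈ ({i, j} : Finset (Fin (N + 1))), x k = y k) →
        (x ∈ {x : Fin (N + 1) → T3 | hsDiameter σ N ≤ Torus.euclidDist (x i) (x j) ∧
            Torus.euclidDist (x i) (x j) ≤ hsDiameter σ N + w} ↔
          y ∈ {x : Fin (N + 1) → T3 | hsDiameter σ N ≤ Torus.euclidDist (x i) (x j) ∧
            Torus.euclidDist (x i) (x j) ≤ hsDiameter σ N + w}) := by
      intro x y hxy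
      have hi : x i = y i := hxy i (Finset.mem_insert_self i {j})
      have hj : x j = y j := hxy j (Finset.mem_insert_of_mem (Finset.mem_singleton_self j))
      simp only [mem_setOf_eq, hi, hj]
    have h1 := posGibbsMeasure_marginal_le ha hσ hσ2 hlam N {i, j} hBm hBI
    rw [Finset.card_pair hij] at h1
    have h2 := volume_pairShell_le hij hε hw hcase
    calc posGibbsMeasure (fun _ : T3 => a) (hsDiameter σ N) (N + 1) _ ≤ 2 ^ 2 * volume _ := h1
      _ ≤ 2 ^ 2 * ENNReal.ofReal (v₁ * ((hsDiameter σ N + w) ^ 3 - hsDiameter σ N ^ 3)) := by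
          gcongr
      _ = ENNReal.ofReal (2 ^ 2 * (v₁ * ((hsDiameter σ N + w) ^ 3 - hsDiameter σ N ^ 3))) := by
          rw [ENNReal.ofReal_mul (p := 2 ^ 2) (by positivity), ENNReal.ofReal_pow zero_le_two,
            ENNReal.ofReal_ofNat]
      _ ≤ _ := by
          refine ENNReal.ofReal_le_ofReal ?_
          have hw1 : w ≤ 1 := by linarith
          have hw3 : w ^ 3 ≤ w ^ 2 := pow_le_pow_of_le_one hw hw1 (by norm_num)
          have h3 : 2 ^ 2 * v₁ * w ^ 3 ≤ 2 ^ 2 * v₁ * w ^ 2 :=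
            mul_le_mul_of_nonneg_left hw3 (by positivity)
          have h4 : 0 ≤ (1 / 2 - hsDiameter σ N)⁻¹ ^ 2 * w ^ 2 := by positivity
          nlinarith [h3, h4]
  · haveI := isProbabilityMeasure_posGibbsMeasure (a₀ := fun _ : T3 => a) continuous_const
      (fun _ => ha) hσ2.le N
    have hws : 1 / 2 - hsDiameter σ N ≤ w := by linarith
    calc posGibbsMeasure (fun _ : T3 => a) (hsDiameter σ N) (N + 1) _ ≤ 1 := prob_le_one
      _ = ENNReal.ofReal 1 := ENNReal.ofReal_one.symm
      _ ≤ _ := by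
          refine ENNReal.ofReal_le_ofReal ?_
          have h1 : 1 ≤ (1 / 2 - hsDiameter σ N)⁻¹ * w := by
            rw [inv_mul_eq_div, le_div_iff₀ hs, one_mul]
            exact hws
          have h2 : 1 ≤ (1 / 2 - hsDiameter σ N)⁻¹ ^ 2 * w ^ 2 := by
            rw [← mul_pow]
            exact one_le_pow₀ h1
          have h3 : 0 ≤ 12 * v₁ * hsDiameter σ N ^ 2 * w := by positivity
          have h4 : 0 ≤ 2 ^ 2 * v₁ * (3 * hsDiameter σ N + 1) * w ^ 2 := by positivity
          nlinarith [h2, h3, h4]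

/-- **Velocity integration of the pair window.**  Under the product Maxwellian law
`⊗ᵢ N(u, θ id)` on `(ℝ³)ⁿ`, for `A, K, δ ≥ 0`:
`∫ (A w + K w²) ≤ A · 2E‖v‖ · δ + 4 K E‖v‖² δ²` with `w = (‖vᵢ‖ + ‖vⱼ‖) δ` (`(a + b)² ≤ 2(a² + b²)`,
and each coordinate has law `N(u, θ id)`, `measurePreserving_eval`; the Gaussian moments are
finite by Fernique, `IsGaussian.memLp_id`). [folklore] -/
theorem lintegral_pairWindow_le (u : V3) (θ : ℝ) {n : ℕ} (i j : Fin n) {A K δ : ℝ}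
    (hA : 0 ≤ A) (hK : 0 ≤ K) (hδ : 0 ≤ δ) :
    ∫⁻ v, ENNReal.ofReal (A * ((‖v i‖ + ‖v j‖) * δ) + K * ((‖v i‖ + ‖v j‖) * δ) ^ 2)
        ∂Measure.pi (fun _ : Fin n => gaussMeasure u θ) ≤
      ENNReal.ofReal (A * (2 * ∫ v, ‖v‖ ∂gaussMeasure u θ) * δ +
        4 * K * (∫ v, ‖v‖ ^ 2 ∂gaussMeasure u θ) * δ ^ 2) := by
  -- one-particle moments and their transport to the coordinates of the product
  have hn1 : Integrable (fun v : V3 => ‖v‖) (gaussMeasure u θ) :=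
    (memLp_one_iff_integrable.1 (IsGaussian.memLp_id (gaussMeasure u θ) 1 (by simp))).norm
  have hn2 : Integrable (fun v : V3 => ‖v‖ ^ 2) (gaussMeasure u θ) :=
    (IsGaussian.memLp_id (gaussMeasure u θ) 2 (by simp)).integrable_norm_pow (by norm_num)
  have hP1 : ∀ k : Fin n, Integrable (fun v : Fin n → V3 => ‖v k‖)
      (Measure.pi fun _ : Fin n => gaussMeasure u θ) := fun k =>
    (measurePreserving_eval (fun _ : Fin n => gaussMeasure u θ) k).integrable_comp_of_integrable hn1
  have hP2 : ∀ k : Fin n, Integrable (fun v : Fin n → V3 => ‖v k‖ ^ 2)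
      (Measure.pi fun _ : Fin n => gaussMeasure u θ) := fun k =>
    (measurePreserving_eval (fun _ : Fin n => gaussMeasure u θ) k).integrable_comp_of_integrable hn2
  have hI1 : ∀ k : Fin n, ∫ v, ‖v k‖ ∂Measure.pi (fun _ : Fin n => gaussMeasure u θ) =
      ∫ v, ‖v‖ ∂gaussMeasure u θ := by
    intro k
    have h := integral_map (μ := Measure.pi fun _ : Fin n => gaussMeasure u θ)
      (measurePreserving_eval (fun _ : Fin n => gaussMeasure u θ) k).measurable.aemeasurable
      (continuous_norm : Continuous fun y : V3 => ‖y‖).aestronglyMeasurable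
    rw [(measurePreserving_eval (fun _ : Fin n => gaussMeasure u θ) k).map_eq] at h
    exact h.symm
  have hI2 : ∀ k : Fin n, ∫ v, ‖v k‖ ^ 2 ∂Measure.pi (fun _ : Fin n => gaussMeasure u θ) =
      ∫ v, ‖v‖ ^ 2 ∂gaussMeasure u θ := by
    intro k
    have h := integral_map (μ := Measure.pi fun _ : Fin n => gaussMeasure u θ)
      (measurePreserving_eval (fun _ : Fin n => gaussMeasure u θ) k).measurable.aemeasurable
      ((continuous_norm : Continuous fun y : V3 => ‖y‖).pow 2).aestronglyMeasurable
    rw [(measurePreserving_eval (fun _ : Fin n => gaussMeasure u θ) k).map_eq] at h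
    exact h.symm
  -- pointwise: `(a + b)² ≤ 2 (a² + b²)`
  have hpt : ∀ v : Fin n → V3,
      A * ((‖v i‖ + ‖v j‖) * δ) + K * ((‖v i‖ + ‖v j‖) * δ) ^ 2 ≤
        A * δ * ‖v i‖ + A * δ * ‖v j‖ + 2 * K * δ ^ 2 * ‖v i‖ ^ 2 +
          2 * K * δ ^ 2 * ‖v j‖ ^ 2 := by
    intro v
    have h2 : (‖v i‖ + ‖v j‖) ^ 2 ≤ 2 * (‖v i‖ ^ 2 + ‖v j‖ ^ 2) := by
      nlinarith [sq_nonneg (‖v i‖ - ‖v j‖)]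
    have h3 : K * δ ^ 2 * (‖v i‖ + ‖v j‖) ^ 2 ≤ K * δ ^ 2 * (2 * (‖v i‖ ^ 2 + ‖v j‖ ^ 2)) :=
      mul_le_mul_of_nonneg_left h2 (by positivity)
    nlinarith [h3]
  have h1 : Integrable (fun v : Fin n → V3 => A * δ * ‖v i‖)
      (Measure.pi fun _ : Fin n => gaussMeasure u θ) := (hP1 i).const_mul _
  have h2 : Integrable (fun v : Fin n → V3 => A * δ * ‖v j‖)
      (Measure.pi fun _ : Fin n => gaussMeasure u θ) := (hP1 j).const_mul _
  have h3 : Integrable (fun v : Fin n → V3 => 2 * K * δ ^ 2 * ‖v i‖ ^ 2)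
      (Measure.pi fun _ : Fin n => gaussMeasure u θ) := (hP2 i).const_mul _
  have h4 : Integrable (fun v : Fin n → V3 => 2 * K * δ ^ 2 * ‖v j‖ ^ 2)
      (Measure.pi fun _ : Fin n => gaussMeasure u θ) := (hP2 j).const_mul _
  have h12 : Integrable (fun v : Fin n → V3 => A * δ * ‖v i‖ + A * δ * ‖v j‖)
      (Measure.pi fun _ : Fin n => gaussMeasure u θ) := h1.add h2
  have h123 : Integrable (fun v : Fin n → V3 => A * δ * ‖v i‖ + A * δ * ‖v j‖ +
      2 * K * δ ^ 2 * ‖v i‖ ^ 2) (Measure.pi fun _ : Fin n => gaussMeasure u θ) := h12.add h3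
  have h1234 : Integrable (fun v : Fin n → V3 => A * δ * ‖v i‖ + A * δ * ‖v j‖ +
      2 * K * δ ^ 2 * ‖v i‖ ^ 2 + 2 * K * δ ^ 2 * ‖v j‖ ^ 2)
      (Measure.pi fun _ : Fin n => gaussMeasure u θ) := h123.add h4
  have hg0 : ∀ v : Fin n → V3, 0 ≤ A * δ * ‖v i‖ + A * δ * ‖v j‖ +
      2 * K * δ ^ 2 * ‖v i‖ ^ 2 + 2 * K * δ ^ 2 * ‖v j‖ ^ 2 := fun v => by positivity
  calc ∫⁻ v, ENNReal.ofReal (A * ((‖v i‖ + ‖v j‖) * δ) + K * ((‖v i‖ + ‖v j‖) * δ) ^ 2)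
        ∂Measure.pi (fun _ : Fin n => gaussMeasure u θ)
      ≤ ∫⁻ v, ENNReal.ofReal (A * δ * ‖v i‖ + A * δ * ‖v j‖ + 2 * K * δ ^ 2 * ‖v i‖ ^ 2 +
          2 * K * δ ^ 2 * ‖v j‖ ^ 2) ∂Measure.pi (fun _ : Fin n => gaussMeasure u θ) :=
        lintegral_mono fun v => ENNReal.ofReal_le_ofReal (hpt v)
    _ = ENNReal.ofReal (∫ v, (A * δ * ‖v i‖ + A * δ * ‖v j‖ + 2 * K * δ ^ 2 * ‖v i‖ ^ 2 +
          2 * K * δ ^ 2 * ‖v j‖ ^ 2) ∂Measure.pi (fun _ : Fin n => gaussMeasure u θ)) :=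
        (ofReal_integral_eq_lintegral_ofReal h1234 (Eventually.of_forall hg0)).symm
    _ = _ := by
        congr 1
        rw [integral_add h123 h4, integral_add h12 h3, integral_add h1 h2, integral_const_mul,
          integral_const_mul, integral_const_mul, integral_const_mul, hI1 i, hI1 j, hI2 i, hI2 j]
        ring

/-- **The pair-window event under the rung-0 product law.**  For `i ≠ j` and `δ ≥ 0`, under
`posGibbsMeasure ⊗ (⊗ᵢ N(u, θ id))`:
`ℙ {ε ≤ d(xᵢ, xⱼ) ≤ ε + (‖vᵢ‖ + ‖vⱼ‖) δ} ≤ 12 v₁ ε² · 2E‖v‖ · δ + 4 K(ε) E‖v‖² δ²`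
(Tonelli with the positions inside, `posGibbsMeasure_pairShell_le` at the window
`w = (‖vᵢ‖ + ‖vⱼ‖) δ`, then `lintegral_pairWindow_le`). [folklore] -/
theorem prod_pairWindow_le {σ a : ℝ} (hσ : 0 < σ) (hσ2 : σ < 1 / 2) (hlam : v₁ * σ ^ 3 ≤ 1 / 2)
    (ha : 0 < a) (u : V3) (θ : ℝ) (N : ℕ) {i j : Fin (N + 1)} (hij : i ≠ j) {δ : ℝ}
    (hδ : 0 ≤ δ) :
    ((posGibbsMeasure (fun _ : T3 => a) (hsDiameter σ N) (N + 1)).prod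
        (Measure.pi fun _ : Fin (N + 1) => gaussMeasure u θ))
      {p | hsDiameter σ N ≤ Torus.euclidDist (p.1 i) (p.1 j) ∧
        Torus.euclidDist (p.1 i) (p.1 j) ≤ hsDiameter σ N + (‖p.2 i‖ + ‖p.2 j‖) * δ} ≤
      ENNReal.ofReal (12 * v₁ * hsDiameter σ N ^ 2 * (2 * ∫ v, ‖v‖ ∂gaussMeasure u θ) * δ +
        4 * (2 ^ 2 * v₁ * (3 * hsDiameter σ N + 1) + (1 / 2 - hsDiameter σ N)⁻¹ ^ 2) * (∫ v, ‖v‖ ^ 2 ∂gaussMeasure u θ) * δ ^ 2) := by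
  haveI := isProbabilityMeasure_posGibbsMeasure (a₀ := fun _ : T3 => a) continuous_const
    (fun _ => ha) hσ2.le N
  have hε : 0 < hsDiameter σ N := hsDiameter_pos hσ N
  have hv := v₁_pos
  have hd : Measurable fun p : (Fin (N + 1) → T3) × (Fin (N + 1) → V3) =>
      Torus.euclidDist (p.1 i) (p.1 j) :=
    (continuous_euclidDist_apply i j).measurable.comp measurable_fst
  have hwm : Measurable fun p : (Fin (N + 1) → T3) × (Fin (N + 1) → V3) =>
      hsDiameter σ N + (‖p.2 i‖ + ‖p.2 j‖) * δ :=
    measurable_const.add ((((measurable_pi_apply i).comp measurable_snd).norm.add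
      ((measurable_pi_apply j).comp measurable_snd).norm).mul_const δ)
  have hF : MeasurableSet {p : (Fin (N + 1) → T3) × (Fin (N + 1) → V3) |
      hsDiameter σ N ≤ Torus.euclidDist (p.1 i) (p.1 j) ∧
        Torus.euclidDist (p.1 i) (p.1 j) ≤ hsDiameter σ N + (‖p.2 i‖ + ‖p.2 j‖) * δ} :=
    (measurableSet_le measurable_const hd).inter (measurableSet_le hd hwm)
  rw [Measure.prod_apply_symm hF]
  have hpt : ∀ v : Fin (N + 1) → V3,
      posGibbsMeasure (fun _ : T3 => a) (hsDiameter σ N) (N + 1)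
        {x : Fin (N + 1) → T3 | hsDiameter σ N ≤ Torus.euclidDist (x i) (x j) ∧
            Torus.euclidDist (x i) (x j) ≤ hsDiameter σ N + (‖v i‖ + ‖v j‖) * δ} ≤
        ENNReal.ofReal (12 * v₁ * hsDiameter σ N ^ 2 * ((‖v i‖ + ‖v j‖) * δ) +
          (2 ^ 2 * v₁ * (3 * hsDiameter σ N + 1) + (1 / 2 - hsDiameter σ N)⁻¹ ^ 2) * ((‖v i‖ + ‖v j‖) * δ) ^ 2) := fun v =>
    posGibbsMeasure_pairShell_le ha hσ hσ2 hlam N hij (w := (‖v i‖ + ‖v j‖) * δ) (by positivity)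
  calc _ ≤ ∫⁻ v, ENNReal.ofReal (12 * v₁ * hsDiameter σ N ^ 2 * ((‖v i‖ + ‖v j‖) * δ) +
          (2 ^ 2 * v₁ * (3 * hsDiameter σ N + 1) + (1 / 2 - hsDiameter σ N)⁻¹ ^ 2) * ((‖v i‖ + ‖v j‖) * δ) ^ 2)
          ∂Measure.pi (fun _ : Fin (N + 1) => gaussMeasure u θ) :=
        lintegral_mono fun v => by simpa only [Set.preimage_setOf_eq] using hpt v
    _ ≤ _ := lintegral_pairWindow_le u θ i j (by positivity) (by have := v₁_pos; positivity) hδ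

/-- **(S1) The one-collision window event is linearly small, with the Boltzmann constant.**  Under the
homogeneous (rung-0) local Gibbs law of `N + 1` hard spheres of diameter `ε = hsDiameter σ N` on `𝕋³`
(constant profiles `a, θ > 0`, `u`; `v₁σ³ ≤ 1/2`, `σ < 1/2`), the probability that some pair `i ≠ j` is at
minimal-image distance in `[ε, ε + (‖vᵢ‖ + ‖vⱼ‖) δ]` is at most
`12 v₁ ε² · (N+1)N · 2E‖v‖ · δ + C₁ δ²` (`v₁ = |B₁|`, so `12 v₁ ε² δ‖·‖ = 4 ·` the shell volume
`4π ε² ‖·‖ δ` to first order, the `4` being the pair-marginal factor of `posGibbsMeasure_marginal_le`).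
[folklore] -/
theorem localGibbsLaw_closePair_le {σ a θ : ℝ} (hσ : 0 < σ) (hσ2 : σ < 1 / 2)
    (hlam : v₁ * σ ^ 3 ≤ 1 / 2) (ha : 0 < a) (hθ : 0 < θ) (u : V3) (N : ℕ)
    (Φ : HardSphereFlow (Torus.geometry (Fin 3)) (hsDiameter σ N) (N + 1)) :
    ∃ C₁ : ℝ, ∀ δ : ℝ, 0 ≤ δ →
      localGibbsLaw σ (fun _ => a) (fun _ => u) (fun _ => θ) N Φ
        {z | ∃ i j : Fin (N + 1), i ≠ j ∧ hsDiameter σ N ≤ Torus.euclidDist (z i).1 (z j).1 ∧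
          Torus.euclidDist (z i).1 (z j).1 ≤ hsDiameter σ N + (‖(z i).2‖ + ‖(z j).2‖) * δ} ≤
        ENNReal.ofReal (12 * v₁ * hsDiameter σ N ^ 2 * ((N + 1 : ℝ) * N) *
          (2 * ∫ v, ‖v‖ ∂gaussMeasure u θ) * δ + C₁ * δ ^ 2) := by
  refine ⟨((N + 1 : ℝ) * N) *
    (4 * (2 ^ 2 * v₁ * (3 * hsDiameter σ N + 1) + (1 / 2 - hsDiameter σ N)⁻¹ ^ 2) * ∫ v, ‖v‖ ^ 2 ∂gaussMeasure u θ), fun δ hδ => ?_⟩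
  have hz : MeasurableEmbedding
      (zipConfig : (Fin (N + 1) → T3) × (Fin (N + 1) → V3) → Config (N + 1) (Fin 3) T3) :=
    (MeasurableEquiv.arrowProdEquivProdArrow T3 V3 (Fin (N + 1))).symm.measurableEmbedding
  rw [localGibbsLaw_eq, localGibbsMeasure_rung0_eq_map σ ha.le hθ u N, hz.map_apply]
  -- the per-pair events in the product coordinates
  set F : Fin (N + 1) × Fin (N + 1) → Set ((Fin (N + 1) → T3) × (Fin (N + 1) → V3)) :=
    fun q => {p | hsDiameter σ N ≤ Torus.euclidDist (p.1 q.1) (p.1 q.2) ∧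
      Torus.euclidDist (p.1 q.1) (p.1 q.2) ≤ hsDiameter σ N + (‖p.2 q.1‖ + ‖p.2 q.2‖) * δ}
    with hF
  have hsub : zipConfig ⁻¹' {z : Config (N + 1) (Fin 3) T3 | ∃ i j : Fin (N + 1), i ≠ j ∧
      hsDiameter σ N ≤ Torus.euclidDist (z i).1 (z j).1 ∧
        Torus.euclidDist (z i).1 (z j).1 ≤ hsDiameter σ N + (‖(z i).2‖ + ‖(z j).2‖) * δ} ⊆
      ⋃ q ∈ (Finset.univ : Finset (Fin (N + 1))).offDiag, F q := by
    intro p hp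
    simp only [mem_preimage, mem_setOf_eq, zipConfig_apply] at hp
    obtain ⟨i, j, hij, h1, h2⟩ := hp
    refine Set.mem_iUnion₂.2 ⟨(i, j), Finset.mem_offDiag.2 ⟨Finset.mem_univ _, Finset.mem_univ _,
      hij⟩, ?_⟩
    exact ⟨h1, h2⟩
  -- the number of ordered pairs
  have hcardN : ((Finset.univ : Finset (Fin (N + 1))).offDiag).card = (N + 1) * N := by
    rw [Finset.offDiag_card, Finset.card_univ, Fintype.card_fin]
    exact Nat.sub_eq_of_eq_add (by ring)
  have hcard : ((((Finset.univ : Finset (Fin (N + 1))).offDiag).card : ℕ) : ℝ≥0∞) =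
      ENNReal.ofReal ((N + 1 : ℝ) * N) := by
    rw [hcardN]
    have e : ((N + 1 : ℝ) * N) = (((N + 1) * N : ℕ) : ℝ) := by push_cast; ring
    rw [e, ENNReal.ofReal_natCast]
  calc ((posGibbsMeasure (fun _ : T3 => a) (hsDiameter σ N) (N + 1)).prod
          (Measure.pi fun _ : Fin (N + 1) => gaussMeasure u θ)) _
      ≤ ((posGibbsMeasure (fun _ : T3 => a) (hsDiameter σ N) (N + 1)).prod
          (Measure.pi fun _ : Fin (N + 1) => gaussMeasure u θ))
          (⋃ q ∈ (Finset.univ : Finset (Fin (N + 1))).offDiag, F q) := measure_mono hsub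
    _ ≤ ∑ q ∈ (Finset.univ : Finset (Fin (N + 1))).offDiag,
          ((posGibbsMeasure (fun _ : T3 => a) (hsDiameter σ N) (N + 1)).prod
            (Measure.pi fun _ : Fin (N + 1) => gaussMeasure u θ)) (F q) :=
        measure_biUnion_finset_le _ _
    _ ≤ ∑ q ∈ (Finset.univ : Finset (Fin (N + 1))).offDiag,
          ENNReal.ofReal (12 * v₁ * hsDiameter σ N ^ 2 * (2 * ∫ v, ‖v‖ ∂gaussMeasure u θ) * δ +
            4 * (2 ^ 2 * v₁ * (3 * hsDiameter σ N + 1) + (1 / 2 - hsDiameter σ N)⁻¹ ^ 2) * (∫ v, ‖v‖ ^ 2 ∂gaussMeasure u θ) * δ ^ 2) :=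
        Finset.sum_le_sum fun q hq =>
          prod_pairWindow_le hσ hσ2 hlam ha u θ N (Finset.mem_offDiag.1 hq).2.2 hδ
    _ = ENNReal.ofReal (((N + 1 : ℝ) * N) *
          (12 * v₁ * hsDiameter σ N ^ 2 * (2 * ∫ v, ‖v‖ ∂gaussMeasure u θ) * δ +
            4 * (2 ^ 2 * v₁ * (3 * hsDiameter σ N + 1) + (1 / 2 - hsDiameter σ N)⁻¹ ^ 2) * (∫ v, ‖v‖ ^ 2 ∂gaussMeasure u θ) * δ ^ 2)) := by
        rw [Finset.sum_const, nsmul_eq_mul, hcard, ← ENNReal.ofReal_mul (by positivity)]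
    _ = _ := by
        congr 1
        ring


/-- **Registered helper stub `stub_windowStaticsOne`** of crux stmt-AtomisticToContinuum-13078
(rung-0 collision-count bound, part 3c: the one-close-pair event with the Boltzmann constant;
= `localGibbsLaw_closePair_le` in signature form). [folklore] -/
theorem stub_windowStaticsOne :
    ∀ (σ a θ : ℝ) (u : V3) (N : ℕ) (Φ : HardSphereFlow (Torus.geometry (Fin 3)) (hsDiameter σ N) (N + 1)), 0 < σ → σ < 1 / 2 → v₁ * σ ^ 3 ≤ 1 / 2 → 0 < a → 0 < θ → ∃ C₁ : ℝ, ∀ δ : ℝ, 0 ≤ δ → localGibbsLaw σ (fun _ => a) (fun _ => u) (fun _ => θ) N Φ {z | ∃ i j : Fin (N + 1), i ≠ j ∧ hsDiameter σ N ≤ Torus.euclidDist (z i).1 (z j).1 ∧ Torus.euclidDist (z i).1 (z j).1 ≤ hsDiameter σ N + (‖(z i).2‖ + ‖(z j).2‖) * δ} ≤ ENNReal.ofReal (12 * v₁ * hsDiameter σ N ^ 2 * ((N + 1 : ℝ) * N) * (2 * ∫ v, ‖v‖ ∂gaussMeasure u θ) * δ + C₁ * δ ^ 2) :=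
  fun _σ _a _θ u N Φ hσ hσ2 hlam ha hθ => localGibbsLaw_closePair_le hσ hσ2 hlam ha hθ u N Φ

end Summit.AtomisticToContinuum.HydrodynamicLimit.Theorems

end
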